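/-
Origin: expansion seat `planner-pub-hodgecm-prl1-g3-0`, handover #12 2026-08-18T06:36:26Z (`HOME/pub-hodgecm-prl1-g3/lean/Prl1g3/ModelCarrier.lean`, md5 529480c9, 362 lines);
landed by the gen-7 packager in gate run 25 as `HodgeCM/Automorphic/ModelCarrier.lean` (verbatim).
-/
/-
Origin: expansion seat `planner-pub-hodgecm-prl1-g3-0` (unit pub-hodgecm-prl1-g3, EXPANSION PROVER a-1 gen 3, CONSTRUCT),
2026-08-18.  Suggested target: `HodgeCM/Automorphic/ModelCarrier.lean` (module `HodgeCM.Automorphic.ModelCarrier`;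
ADDITIVE — nothing landed is replaced; imports landed / run-24 modules only).
-/
import Summits.HodgeConjecture.HodgeCM.Automorphic.CompactApproxBridge
import Summits.HodgeConjecture.HodgeCM.Automorphic.DiscretePart
import Summits.HodgeConjecture.HodgeCM.Automorphic.ThetaCarrierRep_2

/-!
# The core carrier OVER MODELS: the three core analytic axioms per seesaw context replaced by data

Gen 2 posited, per seesaw context, a `CoreCarrier` with TEN core analytic axioms; gen 3 (`ThetaCarrierRep`) made
seven of them theorems and kept THREE (`RepCoreCarrier.Analytic {R_unitary, discreteDecomp, hatτ_complete}`);
the discharge lineage then proved each of the three over a MODEL: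

* `R_unitary`, `discreteDecomp` — over `H := L²(G ⧸ Γ, ν)` for a compact quotient of a locally compact group by a
  discrete cocompact subgroup, `R :=` the regular representation `ρHom ν`
  (`CompactApprox.isUnitaryRep_ρHom`, `CompactApprox.hasCompactApprox_haar` (pv06-g3) +
  `RepDecomp.discreteDecomp_of_compactApprox` (prl1-g3), the Gelfand–Graev–Piatetski-Shapiro argument
  [Getz–Hahn 2024, Thm 9.1.1 / Lemma 9.3.1, pp. 174–179]);
* `hatτ_complete` — over `HG :=` the discrete part `RepDecomp.discPart R_U` of ANY representation `R_U` with
  `hatτ :=` its isotypic components (`RepCoreCarrier.hatτ_complete_of_discPart`, prl1-g3).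

This file assembles them: it packages the models as PROP-FREE DATA (Mathlib objects together with their Mathlib
properties — `IsHaarMeasure`, `IsFundamentalDomain`, `CompactSpace (G ⧸ Γ)`, …; no field states anything about
theta series, periods or cohomology) and proves

* `CoreModelData.toCore_analytic : (X.toCore).Analytic` — **a core carrier built from model data satisfies ALL its
  analytic axioms, with no hypothesis**;
* at `Universe` level, `ModelThetaData.toRep : U.RepThetaCarrier`, `ModelThetaData.toRep_analytic` (the carrier's
  `Analytic` record from the TORUS-side axioms alone) and the headline
  `Assembly.realisationExists_ofModels (M : U.ModelAxioms) (Md : U.ModelThetaData) (hT : Md.TorusAnalytic)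
     (A : (ThetaModel.ofRepCarrier Md.toRep (Md.toRep_analytic hT)).Inputs) (hHR : U.Fact_hodgeRiemann20) :
     U.RealisationExistsPerL ∧ U.RealisationExistsFace`
  — compared with `realisationExists_ofRepCarrier`, the hypothesis `hA : D.Analytic` (15 axioms per context) is
  replaced by `hT : Md.TorusAnalytic` (the 2 × 6 torus-side axioms per context); the 3 core axioms are GONE.

What is NOT claimed.  The identification of PerL's spaces with the models — `[U(W)] = U(W)(L⁺)\U(W)(𝔸)` IS such a
compact quotient `G ⧸ Γ` (anisotropic unitary group), and the `G_U`-side space of PerL AX1b(a) IS the discrete part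
of a regular representation — is a DICTIONARY a referee checks against the text (PerL v5 ll. 264–268, 382–383), not a
theorem of this package (adelic groups are not available in Mathlib).  The torus-side axioms, the theta `Inputs`,
`ModelAxioms` and `Fact_hodgeRiemann20` are untouched and remain hypotheses.
-/

noncomputable section

open MeasureTheory

attribute [-instance] Quotient.instMeasurableSpace

namespace HodgeCM

open HodgeCM.PerL34 HodgeCM.PerL34.QuotientSmoothing

/-! ## 1. MODEL-U: a compact quotient `G ⧸ Γ` with Haar data -/

/-- **Model data for `[U(W)]`**: a locally compact group `G`, a discrete countable closed cocompact subgroup `Γ`, a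
regular Haar measure `μ` on the (unimodular) `G` and a measurable fundamental domain `𝓕` for `Γ` acting on the right.
Every field is a Mathlib object or a Mathlib property of those objects. -/
structure QuotientModel : Type 1 where
  /-- the group `U(W)(𝔸)` of the dictionary -/
  G : Type
  [instGroup : Group G]
  [instTop : TopologicalSpace G]
  [instTopGroup : IsTopologicalGroup G]
  [instLC : LocallyCompactSpace G]
  [instMeas : MeasurableSpace G]
  [instBorel : BorelSpace G]
  /-- the lattice `U(W)(L⁺)` of the dictionary -/
  Γ : Subgroup G
  [instDiscrete : DiscreteTopology Γ]
  [instCountable : Countable Γ]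
  /-- `Γ` is closed -/
  isClosed_Γ : IsClosed (Γ : Set G)
  /-- `Γ` is cocompact -/
  [instCompact : CompactSpace (G ⧸ Γ)]
  /-- a Haar measure on `G` -/
  μ : Measure G
  [instHaar : μ.IsHaarMeasure]
  [instRegular : μ.Regular]
  /-- `G` is unimodular -/
  [instRightInv : μ.IsMulRightInvariant]
  /-- a fundamental domain for the right action of `Γ` -/
  𝓕 : Set G
  /-- … which is one -/
  isFundamentalDomain : IsFundamentalDomain Γ.op 𝓕 μ

namespace QuotientModel

attribute [instance] instGroup instTop instTopGroup instLC instMeas instBorel instDiscrete instCountable instCompact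
  instHaar instRegular instRightInv

variable (Q : QuotientModel)

/-- (Ported verbatim from the HodgeCMPerL package; no docstring in the source.) -/
instance : MeasurableSpace (Q.G ⧸ Q.Γ) := borel _
/-- (Ported verbatim from the HodgeCMPerL package; no docstring in the source.) -/
instance : BorelSpace (Q.G ⧸ Q.Γ) := ⟨rfl⟩

/-- The folded measure `ν = π_* (μ|𝓕)` on `G ⧸ Γ`. -/
def ν : Measure (Q.G ⧸ Q.Γ) := Measure.map (QuotientGroup.mk : Q.G → Q.G ⧸ Q.Γ) (Q.μ.restrict Q.𝓕)

/-- (Ported verbatim from the HodgeCMPerL package; no docstring in the source.) -/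
instance : SMulInvariantMeasure Q.G (Q.G ⧸ Q.Γ) Q.ν := smulInvariantMeasure_map_restrict Q.μ Q.isFundamentalDomain

/-- The model of `L²([U(W)])`: `L²(G ⧸ Γ, ν)`. -/
abbrev H : Type := Lp ℂ 2 Q.ν

/-- The model of the representation `R` of AX9: the regular representation of `G` on `L²(G ⧸ Γ, ν)`. -/
def R : Q.G →* (Q.H →L[ℂ] Q.H) := ρHom Q.ν

/-- (Ported verbatim from the HodgeCMPerL package; no docstring in the source.) -/
theorem R_eq : Q.R = ρHom Q.ν := rfl

/-- `R` is unitary (pv06-g3's `CompactApprox.isUnitaryRep_ρHom`). -/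
theorem isUnitaryRep_R : Spectral.IsUnitaryRep Q.R := CompactApprox.isUnitaryRep_ρHom Q.ν

/-- `R` has the compact-approximation property (pv06-g3's `CompactApprox.hasCompactApprox_haar`: the operators
`R(f)`, `f ∈ C_c(G)`, are compact and approximate the identity strongly). -/
theorem hasCompactApprox_R : RepDecomp.HasCompactApprox Q.R :=
  CompactApprox.hasCompactApprox_haar Q.isClosed_Γ Q.μ Q.isFundamentalDomain

/-- Hence `L²(G ⧸ Γ, ν)` is the closed span of its irreducible closed invariant subspaces. -/
theorem discreteDecomp_R :
    (⨆ V : RepDecomp.Irr Q.R, (V.1 : Submodule ℂ Q.H)).topologicalClosure = ⊤ :=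
  RepDecomp.discreteDecomp_of_compactApprox Q.isUnitaryRep_R Q.hasCompactApprox_R

end QuotientModel

/-! ## 2. MODEL-G: the discrete part of any representation -/

/-- **Model data for the `G_U` side**: any representation `R_U` of any group by bounded operators on a Hilbert space
(intended: the regular representation of `G_U(𝔸)` on `L²([G_U])`); the carrier uses its DISCRETE PART. -/
structure DiscModel : Type 1 where
  /-- the ambient Hilbert space (`L²([G_U])` of the dictionary) -/
  HU : Type
  [instHU₁ : NormedAddCommGroup HU]
  [instHU₂ : InnerProductSpace ℂ HU]
  [instHU₃ : CompleteSpace HU]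
  /-- the acting group (`G_U(𝔸)` of the dictionary) -/
  GU : Type
  [instGU : Group GU]
  /-- the representation -/
  RU : GU →* (HU →L[ℂ] HU)

namespace DiscModel

attribute [instance] instHU₁ instHU₂ instHU₃ instGU

variable (Dm : DiscModel)

/-- The model of PerL's `L²_disc([G_U])`: the discrete part of `R_U` (closed span of the irreducible closed invariant
subspaces). -/
abbrev HG : Type := RepDecomp.discPart Dm.RU

/-- The index of its isotypic decomposition: equivalence classes of irreducibles of the restricted representation. -/
abbrev SigIdxG : Type := RepDecomp.IsoClass (RepDecomp.discRep Dm.RU)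

/-- The isotypic components `τ̂`. -/
def hatτ : Dm.SigIdxG → Submodule ℂ Dm.HG := RepDecomp.isotypic (RepDecomp.discRep Dm.RU)

end DiscModel

/-! ## 3. The core carrier of a pair of models -/

/-- **The remaining (prop-free) data of a core carrier over the two models**: the spaces `C([G_U])`, `𝒮^κ`, the
Weil action on indices, the theta kernel operators and the inclusion `C([G_U]) → L²_disc([G_U])`. -/
structure CoreModelData (Q : QuotientModel) (Dm : DiscModel) : Type 1 where
  /-- `C([G_U])` -/
  CG : Type
  [instCG₁ : NormedAddCommGroup CG]
  [instCG₂ : NormedSpace ℂ CG]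
  /-- `𝒮^κ` -/
  SK : Type
  [instSK : TopologicalSpace SK]
  /-- the Weil action `ω(h)` on `𝒮^κ` -/
  omg : Q.G → SK → SK
  /-- the theta kernel operators `𝒯_Φ` -/
  TΦc : SK → (Q.H →L[ℂ] CG)
  /-- the inclusion `C([G_U]) → L²_disc([G_U])` -/
  inclCG : CG →L[ℂ] Dm.HG

namespace CoreModelData

attribute [instance] instCG₁ instCG₂ instSK

variable {Q : QuotientModel} {Dm : DiscModel} (X : CoreModelData Q Dm)

/-- **The core carrier of the models**: `H := L²(G ⧸ Γ, ν)`, `R :=` the regular representation,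
`HG := discPart R_U`, `τ̂ :=` the isotypic components of the discrete part. -/
def toCore : RepCoreCarrier Q.H Dm.HG X.CG Q.G X.SK Dm.SigIdxG where
  R := Q.R
  omg := X.omg
  TΦc := X.TΦc
  inclCG := X.inclCG
  hatτ := Dm.hatτ

/-- (Ported verbatim from the HodgeCMPerL package; no docstring in the source.) -/
@[simp] theorem toCore_R : X.toCore.R = Q.R := rfl
/-- (Ported verbatim from the HodgeCMPerL package; no docstring in the source.) -/
@[simp] theorem toCore_hatτ : X.toCore.hatτ = Dm.hatτ := rfl

/-- **The strengthened analytic record of the model carrier, with NO hypothesis.** -/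
theorem toCore_analyticK : X.toCore.AnalyticK where
  R_unitary := Q.isUnitaryRep_R
  compactApprox := Q.hasCompactApprox_R
  hatτ_complete := RepCoreCarrier.hatτ_complete_of_discPart Dm.RU X.toCore rfl

/-- **The three core analytic axioms of the model carrier hold, with NO hypothesis.** -/
theorem toCore_analytic : X.toCore.Analytic := X.toCore_analyticK.toAnalytic

end CoreModelData

/-! ## 4. `Universe` level: a representation-theoretic theta carrier whose cores are model carriers -/

namespace Universe

variable (U : Universe)

/-- **Model theta data**: `U.RepThetaCarrier` with, per `(L, ι₁, V)`, a `DiscModel` for the `G_U` side and, per seesaw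
context, a `QuotientModel` for the `U(W)` side and the remaining core data; torus sides and theta forms as before.
NO propositional content beyond the Mathlib properties inside the two model records. -/
structure ModelThetaData where
  /-- the `G_U`-side model of `(L, ι₁, V)` -/
  disc : ∀ (L : CMField) (ι₁ : L →+* ℂ), HermSpace3 L ι₁ → DiscModel
  /-- degree-two classes of `P_Γ` as vectors of `L²_disc([G_U])` -/
  emb : ∀ {L : CMField} {ι₁ : L →+* ℂ} {V : HermSpace3 L ι₁} (Γ : Level V),
    U.CohC (U.pms L ι₁ V Γ) 2 →ₗ[ℂ] (disc L ι₁ V).HG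
  /-- the covering `P_{Γ'} → P_Γ` for `Γ' ≤ Γ` -/
  cover : ∀ {L : CMField} {ι₁ : L →+* ℂ} {V : HermSpace3 L ι₁} (Γ Γ' : Level V),
    Γ'.Γ ≤ Γ.Γ → U.Mor (U.pms L ι₁ V Γ') (U.pms L ι₁ V Γ)
  /-- sign recipe, first half -/
  kappa : ∀ (K L : CMField), (K →+* L) → (L →+* ℂ) → (L →+* ℂ) → (K →+* ℂ)
  /-- sign recipe, second half -/
  frameSign : ∀ (L : CMField), (L →+* ℂ) → (L →+* ℂ) → Bool
  /-- the `U(W)`-side model of the context -/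
  quot : ∀ {L : CMField} {ι₁ : L →+* ℂ}, HermSpace3 L ι₁ → SeesawCtx L → QuotientModel
  /-- the remaining core data of the context -/
  coreData : ∀ {L : CMField} {ι₁ : L →+* ℂ} (V : HermSpace3 L ι₁) (c : SeesawCtx L),
    CoreModelData (quot V c) (disc L ι₁ V)
  /-- the (12) torus side -/
  t12 : ∀ {L : CMField} {ι₁ : L →+* ℂ} (V : HermSpace3 L ι₁) (c : SeesawCtx L),
    RepTorusCarrier (coreData V c).toCore
  /-- the (34) torus side -/
  t34 : ∀ {L : CMField} {ι₁ : L →+* ℂ} (V : HermSpace3 L ι₁) (c : SeesawCtx L),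
    RepTorusCarrier (coreData V c).toCore
  /-- the theta one-forms of type `Ψ_i` at level `Γ` -/
  Theta : ∀ {L : CMField} {ι₁ : L →+* ℂ} (V : HermSpace3 L ι₁), SeesawCtx L → Fin 4 → ∀ Γ : Level V,
    Set (U.CohC (U.pms L ι₁ V Γ) 1)

namespace ModelThetaData

variable {U}
variable (Md : U.ModelThetaData)

/-- **The representation-theoretic theta carrier of model theta data.** -/
def toRep : U.RepThetaCarrier where
  HG := fun L ι₁ V => (Md.disc L ι₁ V).HG
  emb := Md.emb
  cover := Md.cover
  kappa := Md.kappa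
  frameSign := Md.frameSign
  H := fun V c => (Md.quot V c).H
  CG := fun V c => (Md.coreData V c).CG
  G := fun V c => (Md.quot V c).G
  SK := fun V c => (Md.coreData V c).SK
  SigIdxG := fun {L} {ι₁} V _ => (Md.disc L ι₁ V).SigIdxG
  core := fun V c => (Md.coreData V c).toCore
  t12 := Md.t12
  t34 := Md.t34
  Theta := Md.Theta

/-- (Ported verbatim from the HodgeCMPerL package; no docstring in the source.) -/
@[simp] theorem toRep_core {L : CMField} {ι₁ : L →+* ℂ} (V : HermSpace3 L ι₁) (c : SeesawCtx L) :
    Md.toRep.core V c = (Md.coreData V c).toCore := rfl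

/-- **The torus-side analytic hypotheses** (2 × 6 per seesaw context) — all that remains of `RepThetaCarrier.Analytic`
for a carrier built from models. -/
structure TorusAnalytic : Prop where
  t12 : ∀ {L : CMField} {ι₁ : L →+* ℂ} (V : HermSpace3 L ι₁) (c : SeesawCtx L), (Md.t12 V c).Analytic
  t34 : ∀ {L : CMField} {ι₁ : L →+* ℂ} (V : HermSpace3 L ι₁) (c : SeesawCtx L), (Md.t34 V c).Analytic

/-- **The core analytic axioms of every context hold for a carrier built from models** — no hypothesis. -/
theorem core_analytic {L : CMField} {ι₁ : L →+* ℂ} (V : HermSpace3 L ι₁) (c : SeesawCtx L) :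
    (Md.toRep.core V c).Analytic :=
  (Md.coreData V c).toCore_analytic

/-- **The full analytic record of the model carrier from the torus-side axioms alone.** -/
theorem toRep_analytic (hT : Md.TorusAnalytic) : Md.toRep.Analytic where
  core := fun V c => Md.core_analytic V c
  t12 := hT.t12
  t34 := hT.t34

end ModelThetaData

end Universe

/-! ## 5. The headline theorems over models -/

namespace Assembly

open HodgeCM.Universe (ModelThetaData ThetaModel)

variable (U : Universe)

/-- **Both realisation inputs over MODELS** (the prl1 target pair): hypotheses = model facts `M`, model theta DATA
`Md`, the TORUS-side analytic axioms `hT` (2 × 6 per context), the ten theta inputs `A`, Hodge–Riemann for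
`(2,0)`-forms.  Compared with `realisationExists_ofRepCarrier` the three CORE analytic axioms per context
(`R_unitary`, `discreteDecomp`, `hatτ_complete`) no longer appear: they are theorems of the models. -/
theorem realisationExists_ofModels (M : U.ModelAxioms) (Md : U.ModelThetaData) (hT : Md.TorusAnalytic)
    (A : (ThetaModel.ofRepCarrier Md.toRep (Md.toRep_analytic hT)).Inputs) (hHR : U.Fact_hodgeRiemann20) :
    U.RealisationExistsPerL ∧ U.RealisationExistsFace :=
  realisationExists_ofRepCarrier U M Md.toRep (Md.toRep_analytic hT) A hHR

/-- **PerL over models.** -/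
theorem perL_ofModels (M : U.ModelAxioms) (Md : U.ModelThetaData) (hT : Md.TorusAnalytic)
    (A : (ThetaModel.ofRepCarrier Md.toRep (Md.toRep_analytic hT)).Inputs) (hHR : U.Fact_hodgeRiemann20) :
    U.PerL :=
  perL_ofRepCarrier U M Md.toRep (Md.toRep_analytic hT) A hHR

/-- **COR-CM, END STATE over models.** -/
theorem COR_CM_endState_ofModels (M : U.ModelAxioms) (h29 : U.Fact_weightSpan) (h30 : U.Fact_weightHodge)
    (hE : U.Qw8ExtProd) (hD : U.Qw8DualPushPull) (hMi : U.Qw8Milne) (Md : U.ModelThetaData)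
    (hT : Md.TorusAnalytic) (A : (ThetaModel.ofRepCarrier Md.toRep (Md.toRep_analytic hT)).Inputs)
    (hHR : U.Fact_hodgeRiemann20) : U.HC_CM :=
  COR_CM_endState_ofRepCarrier U M h29 h30 hE hD hMi Md.toRep (Md.toRep_analytic hT) A hHR

end Assembly

/-! ## 6. Satisfiability of the model data (sanity, adversary-facing)

The data records are inhabited by honest Mathlib objects — so the headline theorems are not vacuously quantified.
(`CoreModelData` / `ModelThetaData` additionally involve the posited `Universe` and are inhabited as soon as it is.) -/

namespace ModelSanity

/-- (Ported verbatim from the HodgeCMPerL package; no docstring in the source.) -/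
local instance : MeasurableSpace Circle := borel _
/-- (Ported verbatim from the HodgeCMPerL package; no docstring in the source.) -/
local instance : BorelSpace Circle := ⟨rfl⟩

/-- (Ported verbatim from the HodgeCMPerL package; no docstring in the source.) -/
theorem isFundamentalDomain_univ_bot :
    IsFundamentalDomain (⊥ : Subgroup Circle).op (Set.univ : Set Circle) Measure.haar :=
  IsFundamentalDomain.mk' nullMeasurableSet_univ fun x => ⟨1, Set.mem_univ _, fun g _ => by
    ext
    have := g.2
    simp only [Subgroup.mem_op, Subgroup.mem_bot] at this
    simpa using congrArg MulOpposite.op this⟩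

/-- The compact group `Circle` with the trivial lattice, its Haar measure and the whole group as fundamental domain
is a `QuotientModel`. -/
example : QuotientModel where
  G := Circle
  Γ := ⊥
  isClosed_Γ := by rw [Subgroup.coe_bot]; exact isClosed_singleton
  μ := Measure.haar
  𝓕 := Set.univ
  isFundamentalDomain := isFundamentalDomain_univ_bot

/-- The trivial representation of the trivial group on `ℂ` is a `DiscModel`. -/
example : DiscModel where
  HU := ℂ
  GU := Unit
  RU := 1

end ModelSanity

end HodgeCM

end
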